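/-
Copyright (c) 2026 the pub-hodgecm-mathlib formalisation cell (harness21).  Prover seat hodgecm-mathlib-K2E2-p12 (g6): Track B «K2-LIT», ENGINE E1,
h413 = stmt-HodgeConjecture-24833; line `K2_E1_TraceFormulaBeta`, 5Res campaign «ENDGAME BY FAMILIES», ROADCARD §3′ amendment #2 (228)∕(234) of K2E1-plan (g7), deal (S2):
THE PURE-TENSOR HECKE OPERATOR FAMILY `𝓐 = {π_∞(a) ∘ π_f(b)}` — translation law (A1), non-degeneracy (A2), adjoints (A3), compression (C) and separate-variables commutation (S2).
-/
import Literature.NumberTheory.Automorphic.UnitaryGroupIntegratedOperatorArchFinSplit   -- ★ `integratedOperator` `*`-calculus (`IntegratedOperatorStar`), `cmDatum`, `archToAdelic`, `finAdelicToAdelic`, `commute_archToAdelic_finAdelicToAdelic`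
import Literature.NumberTheory.Automorphic.IntegratedOperatorDiracSequence             -- ★ `IsDiracSequence`, `tendsto_integratedOperator_apply`, `exists_isDiracSequence`
import HarnessLib

/-!
# K2·E1 — `K2E1PureTensorHeckeAlgebraU` (deal (S2)): THE PURE-TENSOR OPERATOR FAMILY `𝓐 = {π|_{G₁}(a) ∘ π|_{G₂}(b)}` OF A REPRESENTATION OF `G ⊇ ι₁(G₁)·ι₂(G₂)` (E1: `G(𝔸) = G_∞ · G_f`)
# IS TRANSLATION-STABLE (A1), NON-DEGENERATE (A2) AND `†`-STABLE (A3) — the hypotheses `h𝓐 hnd hstar` of ★ `K2E1HeckeModuleIrreducibleSchurU` (p860278) — WITH THE COMPRESSION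
# IDENTITY (C) AND THE SEPARATE-VARIABLES COMMUTATION (S2) [Deitmar–Echterhoff Prop. 6.2.1, Lemma 6.2.2; Gelbart (10.12)–(10.13); Borel–Jacquet §4.1]

Track B ∕ K2-LIT, crux h413 = `stmt-HodgeConjecture-24833`, route of record `HCCMUnconditional`; cell `hodgecm-mathlib`, squad K2, ENGINE E1 (5Res campaign, M2 v2 §3′.1 (ii′): «an
irreducible `π` has an archimedean Hecke eigenvalue on its `(τ, K′)`-block», D5′ proper of K2E4-p23).  THEOREMS ONLY (no `def`, no `instance`, no notation, no named-fact hypothesis, no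
`sorry`; default heartbeats); lane `--supports stmt-HodgeConjecture-24833 --as helper` (count-neutral).  CLOSES NO SOCKET.

DESIGN.  ★ p860278 `exists_apply_eq_smul_of_commute_compression` takes an ABSTRACT operator set `𝓐` with (A1) `h𝓐 : ∀ g, ∀ A ∈ 𝓐, (π g).comp A ∈ 𝓐`, (A2) `hnd : ∀ v, (∀ A ∈ 𝓐,
A v = 0) → v = 0`, (A3) `hstar : ∀ A ∈ 𝓐, A† ∈ 𝓐`.  For `G(𝔸) = G_∞ · G_f` NO SUMS ARE NEEDED: the set of PURE TENSORS `𝓐 = {R₁ a ∘L R₂ b : a ∈ C_c(G₁), b ∈ C_c(G₂)}`, `R₁ a =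
π|_{G₁}(a) = ∫ a(x) π(ι₁ x) dη₁`, `R₂ b = π|_{G₂}(b)` (★ `ContRepresentation.integratedOperator` of the restrictions ★ `π.restrict ιᵢ`), already has all three properties.
§1 is GENERIC: any topological group `G`, any two continuous homomorphisms `ι₁ : G₁ →* G`, `ι₂ : G₂ →* G` with COMMUTING IMAGES (`hcomm : ∀ x y, ι₁ x * ι₂ y = ι₂ y * ι₁ x`; for (A1) also
`hsurj : ∀ g, ∃ x y, g = ι₁ x * ι₂ y`), any unitary strongly continuous `π` on a Hilbert space, measures `η₁, η₂` finite on compacta (left-invariant for (A1), inversion-invariant for (A3)).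
* §1.1 `restrict_comp_integratedOperator_comm` — `π(ι₂ y) ∘ R₁ a = R₁ a ∘ π(ι₂ y)`; `integratedOperator_restrict_comm` — `R₁ a ∘ R₂ b = R₂ b ∘ R₁ a`; `comp_integratedOperator_comm_of_forall` —
  an operator commuting with every `π(ι₂ y)` commutes with every `R₂ b` (Bochner integrals pass bounded operators).
* §1.2 **(A1) `comp_pureTensor_mem`** — `π(ι₁x ι₂y) ∘ R₁a ∘ R₂b = R₁(λ_x a) ∘ R₂(λ_y b)` (★ `apply_comp_integratedOperator`); **(A3) `adjoint_pureTensor_mem`** — `(R₁a R₂b)† = R₁a* ∘ R₂b*`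
  (★ `adjoint_integratedOperator`); **(A2) `eq_zero_of_forall_pureTensor_apply_eq_zero`** — along Dirac sequences `R₁(φ_n) R₂(ψ_m) v → v` (★ `tendsto_integratedOperator_apply`), and the
  instance edition `pureTensor_nondegenerate` (★ `exists_isDiracSequence`).
* §1.3 **(C) `compression_pureTensor`** — for `P` commuting with every `π(ι₂ y)` (E1: the `K_∞`-type projector `P_τ`) and `R₂e R₂b R₂e = R₂(e⋆b⋆e)`:
  `(P R₂e)(R₁a R₂b)(P R₂e) = (P R₁a P) ∘ R₂(e⋆b⋆e)` (the arch factor `P_τ R₁a P_τ = R₁(e_τ⋆a⋆e_τ)` is the model's business); **(S2) `commute_pureTensor_of_separate`** —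
  `Commute (R₁h ∘ R₂e) (P ∘ R₂t)` once `R₁h` commutes with `P` (`h` `(τ,τ)`-spherical) and `R₂e` with `R₂t` (`t` bi-`K′`-invariant: `e⋆t = t⋆e`).
* §2 THE E1 PRINT at ★ `cmDatum L N H` (`G_∞ = arch`, `G_f = finAdelic`, `ι₁ = archToAdelic`, `ι₂ = finAdelicToAdelic`; `hcomm`, `hsurj` by ★ `commute_archToAdelic_finAdelicToAdelic`,
  ★ `archToAdelic_mul_finAdelicToAdelic`): `cm_comp_pureTensor_mem`, `cm_adjoint_pureTensor_mem`, `cm_eq_zero_of_forall_pureTensor_apply_eq_zero` — p860278's `h𝓐 ∕ hstar ∕ hnd` verbatim.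
HONEST LABEL: HC_CM is proved only modulo the 7 printed citations (2 remaining named inputs: hLiu418 = `stmt-HodgeConjecture-24832`, h413 = `stmt-HodgeConjecture-24833`) until rung 0
closes; this file asserts no named fact and closes no socket; count-neutral; unconditional.

## References
* [DeitmarEchterhoff2014] A. Deitmar, S. Echterhoff, *Principles of Harmonic Analysis* (2nd ed., 2014): Prop. 6.2.1 (`π(f)` is a `*`-representation), Lemma 6.2.2 (Dirac nets), Lemma 6.1.7.
* [Gelbart1975] S. Gelbart, *Automorphic Forms on Adele Groups* (1975): (10.12)–(10.13) (pure tensors `R(Φ) = R_S ∘ τ`).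
* [BorelJacquet1979] A. Borel, H. Jacquet, *Automorphic forms and automorphic representations*, PSPM 33.1 (1979): §4.1.
* [Knapp1986] A. W. Knapp, *Representation Theory of Semisimple Groups* (1986): VIII §3 (Hecke modules of `K`-types).
-/

set_option autoImplicit false
set_option linter.dupNamespace false -- the mandated namespace repeats `HodgeConjecture.HodgeConjecture`

noncomputable section

open MeasureTheory Filter Topology CompactlySupported NumberField
open Literature.NumberTheory.Automorphic Literature.NumberTheory.Automorphic.UnitaryGroup AdelicGroupData
open scoped InnerProductSpace

namespace Summit.HodgeConjecture.HodgeConjecture.Cruxes.H413.K2E1PureTensorHeckeAlgebraU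

/-! ## §1 Generic: two commuting restricted representations -/

section Generic

variable {G G₁ G₂ V : Type*} [Group G] [TopologicalSpace G]
  [Group G₁] [TopologicalSpace G₁] [IsTopologicalGroup G₁] [MeasurableSpace G₁] [BorelSpace G₁]
  [Group G₂] [TopologicalSpace G₂] [IsTopologicalGroup G₂] [MeasurableSpace G₂] [BorelSpace G₂]
  [NormedAddCommGroup V] [InnerProductSpace ℂ V] [CompleteSpace V]
  (π : ContRepresentation ℂ G V) (hu : π.IsUnitary) (hc : π.IsStronglyContinuous)
  (ι₁ : G₁ →* G) (hι₁ : Continuous ι₁) (ι₂ : G₂ →* G) (hι₂ : Continuous ι₂)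
  (η₁ : Measure G₁) (η₂ : Measure G₂) [IsFiniteMeasureOnCompacts η₁] [IsFiniteMeasureOnCompacts η₂]

/-! ### §1.1 Commutations -/

omit [IsTopologicalGroup G₂] in
/-- **An operator commuting with every `π(ι₂ y)` commutes with every `R₂ b = π|_{G₂}(b)`** (bounded operators pass under the Bochner integral). [cite: DeitmarEchterhoff2014, Prop. 6.2.1] -/
theorem comp_integratedOperator_comm_of_forall (P : V →L[ℂ] V) (hP : ∀ y : G₂, P ∘L π (ι₂ y) = π (ι₂ y) ∘L P) (b : C_c(G₂, ℂ)) :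
    P ∘L (π.restrict ι₂).integratedOperator (hu.restrict ι₂) (hc.restrict ι₂ hι₂) η₂ b =
      (π.restrict ι₂).integratedOperator (hu.restrict ι₂) (hc.restrict ι₂ hι₂) η₂ b ∘L P := by
  ext v
  rw [ContinuousLinearMap.comp_apply, ContinuousLinearMap.comp_apply, ContRepresentation.integratedOperator_apply, ContRepresentation.integratedOperator_apply,
    ← ContinuousLinearMap.integral_comp_comm P (ContRepresentation.integrable_smul_apply (hc.restrict ι₂ hι₂) η₂ b v)]
  refine integral_congr_ae (Eventually.of_forall fun y => ?_)
  change P (b y • π (ι₂ y) v) = b y • π (ι₂ y) (P v)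
  rw [ContinuousLinearMap.map_smul, ← ContinuousLinearMap.comp_apply, hP y, ContinuousLinearMap.comp_apply]

omit [IsTopologicalGroup G₁] [TopologicalSpace G₂] [IsTopologicalGroup G₂] [MeasurableSpace G₂] [BorelSpace G₂] in
/-- **`π(ι₂ y)` COMMUTES WITH `R₁ a = π|_{G₁}(a)`** when the images of `ι₁`, `ι₂` commute (E1: `(1, g_f)` with `π_∞(a)`). [cite: Gelbart1975, (10.12)–(10.13)] [cite: BorelJacquet1979, §4.1] -/
theorem restrict_comp_integratedOperator_comm (hcomm : ∀ (x : G₁) (y : G₂), ι₁ x * ι₂ y = ι₂ y * ι₁ x) (y : G₂) (a : C_c(G₁, ℂ)) :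
    π (ι₂ y) ∘L (π.restrict ι₁).integratedOperator (hu.restrict ι₁) (hc.restrict ι₁ hι₁) η₁ a =
      (π.restrict ι₁).integratedOperator (hu.restrict ι₁) (hc.restrict ι₁ hι₁) η₁ a ∘L π (ι₂ y) := by
  ext v
  rw [ContinuousLinearMap.comp_apply, ContinuousLinearMap.comp_apply, ContRepresentation.integratedOperator_apply, ContRepresentation.integratedOperator_apply,
    ← ContinuousLinearMap.integral_comp_comm (π (ι₂ y)) (ContRepresentation.integrable_smul_apply (hc.restrict ι₁ hι₁) η₁ a v)]
  refine integral_congr_ae (Eventually.of_forall fun x => ?_)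
  change π (ι₂ y) (a x • π (ι₁ x) v) = a x • π (ι₁ x) (π (ι₂ y) v)
  rw [ContinuousLinearMap.map_smul, ← mul_apply_eq_comp (π (ι₂ y)) (π (ι₁ x)) v, ← mul_apply_eq_comp (π (ι₁ x)) (π (ι₂ y)) v,
    ← map_mul π, ← map_mul π, hcomm]

omit [IsTopologicalGroup G₁] [IsTopologicalGroup G₂] in
/-- **THE TWO PARTIAL INTEGRATED OPERATORS COMMUTE: `R₁ a ∘ R₂ b = R₂ b ∘ R₁ a`** (generic form of ★ `integratedOperator_arch_comm_fin`). [cite: Gelbart1975, (10.12)–(10.13)] [cite: BorelJacquet1979, §4.1] -/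
theorem integratedOperator_restrict_comm (hcomm : ∀ (x : G₁) (y : G₂), ι₁ x * ι₂ y = ι₂ y * ι₁ x) (a : C_c(G₁, ℂ)) (b : C_c(G₂, ℂ)) :
    (π.restrict ι₁).integratedOperator (hu.restrict ι₁) (hc.restrict ι₁ hι₁) η₁ a ∘L (π.restrict ι₂).integratedOperator (hu.restrict ι₂) (hc.restrict ι₂ hι₂) η₂ b =
      (π.restrict ι₂).integratedOperator (hu.restrict ι₂) (hc.restrict ι₂ hι₂) η₂ b ∘L (π.restrict ι₁).integratedOperator (hu.restrict ι₁) (hc.restrict ι₁ hι₁) η₁ a :=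
  (comp_integratedOperator_comm_of_forall π hu hc ι₂ hι₂ η₂ _ (fun y => (restrict_comp_integratedOperator_comm π hu hc ι₁ hι₁ ι₂ η₁ hcomm y a).symm) b)

/-! ### §1.2 (A1) translation, (A3) adjoint, (A2) non-degeneracy of the pure tensors -/

/-- **(A1) THE PURE TENSORS ARE TRANSLATION-STABLE**: for `g = ι₁ x · ι₂ y`, `π(g) ∘ (R₁ a ∘ R₂ b) = R₁(λ_x a) ∘ R₂(λ_y b)` with `(λ_x a)(u) = a(x⁻¹ u)` — the hypothesis `h𝓐` of ★ p860278
`exists_apply_eq_smul_of_commute_compression` for `𝓐 = {R₁ a ∘L R₂ b}` (left-invariant `η₁, η₂`; every `g` a product). [cite: DeitmarEchterhoff2014, Prop. 6.2.1] [cite: Gelbart1975, (10.12)–(10.13)] -/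
theorem comp_pureTensor_mem [MeasurableMul G₁] [MeasurableMul G₂] [η₁.IsMulLeftInvariant] [η₂.IsMulLeftInvariant]
    (hcomm : ∀ (x : G₁) (y : G₂), ι₁ x * ι₂ y = ι₂ y * ι₁ x) (hsurj : ∀ g : G, ∃ (x : G₁) (y : G₂), g = ι₁ x * ι₂ y) (g : G) (A : V →L[ℂ] V)
    (hA : A ∈ {A : V →L[ℂ] V | ∃ (a : C_c(G₁, ℂ)) (b : C_c(G₂, ℂ)),
      A = (π.restrict ι₁).integratedOperator (hu.restrict ι₁) (hc.restrict ι₁ hι₁) η₁ a ∘L (π.restrict ι₂).integratedOperator (hu.restrict ι₂) (hc.restrict ι₂ hι₂) η₂ b}) :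
    (π g).comp A ∈ {A : V →L[ℂ] V | ∃ (a : C_c(G₁, ℂ)) (b : C_c(G₂, ℂ)),
      A = (π.restrict ι₁).integratedOperator (hu.restrict ι₁) (hc.restrict ι₁ hι₁) η₁ a ∘L (π.restrict ι₂).integratedOperator (hu.restrict ι₂) (hc.restrict ι₂ hι₂) η₂ b} := by
  obtain ⟨a, b, rfl⟩ := hA
  obtain ⟨x, y, rfl⟩ := hsurj g
  obtain ⟨a', ha'⟩ := exists_compactlySupported_leftTranslate x a
  obtain ⟨b', hb'⟩ := exists_compactlySupported_leftTranslate y b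
  refine ⟨a', b', ?_⟩
  have h₁ := ContRepresentation.apply_comp_integratedOperator (hu.restrict ι₁) (hc.restrict ι₁ hι₁) η₁ x a a' ha'
  have h₂ := ContRepresentation.apply_comp_integratedOperator (hu.restrict ι₂) (hc.restrict ι₂ hι₂) η₂ y b b' hb'
  rw [ContRepresentation.restrict_apply] at h₁ h₂
  rw [map_mul, ContinuousLinearMap.mul_def, ContinuousLinearMap.comp_assoc, ← ContinuousLinearMap.comp_assoc (π (ι₂ y)),
    restrict_comp_integratedOperator_comm π hu hc ι₁ hι₁ ι₂ η₁ hcomm y a, ContinuousLinearMap.comp_assoc, h₂, ← ContinuousLinearMap.comp_assoc, h₁]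

/-- **(A3) THE PURE TENSORS ARE `†`-STABLE**: `(R₁ a ∘ R₂ b)† = R₂ b* ∘ R₁ a* = R₁ a* ∘ R₂ b*` (`a*(u) = conj a(u⁻¹)`; inversion-invariant `η₁, η₂`) — the hypothesis `hstar` of ★ p860278.
[cite: DeitmarEchterhoff2014, Prop. 6.2.1] [cite: Gelbart1975, Lemma 10.6] -/
theorem adjoint_pureTensor_mem [MeasurableInv G₁] [MeasurableInv G₂] [η₁.IsInvInvariant] [η₂.IsInvInvariant]
    (hcomm : ∀ (x : G₁) (y : G₂), ι₁ x * ι₂ y = ι₂ y * ι₁ x) (A : V →L[ℂ] V)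
    (hA : A ∈ {A : V →L[ℂ] V | ∃ (a : C_c(G₁, ℂ)) (b : C_c(G₂, ℂ)),
      A = (π.restrict ι₁).integratedOperator (hu.restrict ι₁) (hc.restrict ι₁ hι₁) η₁ a ∘L (π.restrict ι₂).integratedOperator (hu.restrict ι₂) (hc.restrict ι₂ hι₂) η₂ b}) :
    ContinuousLinearMap.adjoint A ∈ {A : V →L[ℂ] V | ∃ (a : C_c(G₁, ℂ)) (b : C_c(G₂, ℂ)),
      A = (π.restrict ι₁).integratedOperator (hu.restrict ι₁) (hc.restrict ι₁ hι₁) η₁ a ∘L (π.restrict ι₂).integratedOperator (hu.restrict ι₂) (hc.restrict ι₂ hι₂) η₂ b} := by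
  obtain ⟨a, b, rfl⟩ := hA
  obtain ⟨a', ha'⟩ := exists_compactlySupported_mulStar a
  obtain ⟨b', hb'⟩ := exists_compactlySupported_mulStar b
  refine ⟨a', b', ?_⟩
  rw [ContinuousLinearMap.adjoint_comp, ContRepresentation.adjoint_integratedOperator (hu.restrict ι₁) (hc.restrict ι₁ hι₁) η₁ a a' ha',
    ContRepresentation.adjoint_integratedOperator (hu.restrict ι₂) (hc.restrict ι₂ hι₂) η₂ b b' hb', integratedOperator_restrict_comm π hu hc ι₁ hι₁ ι₂ hι₂ η₁ η₂ hcomm a' b']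

omit [IsTopologicalGroup G₁] [IsTopologicalGroup G₂] in
/-- **(A2) THE PURE TENSORS ARE NON-DEGENERATE**: if `R₁(φ_n) R₂(ψ_m) v = 0` along Dirac sequences `φ, ψ` then `v = 0` (`R₁(φ_n) w → w`, `R₂(ψ_m) v → v`, ★ `tendsto_integratedOperator_apply`) —
the hypothesis `hnd` of ★ p860278. [cite: DeitmarEchterhoff2014, Lemma 6.2.2] -/
theorem eq_zero_of_forall_pureTensor_apply_eq_zero {φ : ℕ → C_c(G₁, ℂ)} {ψ : ℕ → C_c(G₂, ℂ)}
    (hφ : IsDiracSequence η₁ φ) (hψ : IsDiracSequence η₂ ψ) (v : V)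
    (hv : ∀ A ∈ {A : V →L[ℂ] V | ∃ (a : C_c(G₁, ℂ)) (b : C_c(G₂, ℂ)),
      A = (π.restrict ι₁).integratedOperator (hu.restrict ι₁) (hc.restrict ι₁ hι₁) η₁ a ∘L (π.restrict ι₂).integratedOperator (hu.restrict ι₂) (hc.restrict ι₂ hι₂) η₂ b}, A v = 0) :
    v = 0 := by
  -- each `w_m = R₂(ψ_m) v` is killed by every `R₁(φ_n)`, hence `w_m = 0`
  have hw : ∀ m, (π.restrict ι₂).integratedOperator (hu.restrict ι₂) (hc.restrict ι₂ hι₂) η₂ (ψ m) v = 0 := by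
    intro m
    have ht := hφ.tendsto_integratedOperator_apply (hu.restrict ι₁) (hc.restrict ι₁ hι₁) ((π.restrict ι₂).integratedOperator (hu.restrict ι₂) (hc.restrict ι₂ hι₂) η₂ (ψ m) v)
    have h0 : (fun n => (π.restrict ι₁).integratedOperator (hu.restrict ι₁) (hc.restrict ι₁ hι₁) η₁ (φ n)
        ((π.restrict ι₂).integratedOperator (hu.restrict ι₂) (hc.restrict ι₂ hι₂) η₂ (ψ m) v)) = fun _ => 0 :=
      funext fun n => hv _ ⟨φ n, ψ m, rfl⟩
    rw [h0] at ht
    exact (tendsto_nhds_unique tendsto_const_nhds ht).symm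
  have ht := hψ.tendsto_integratedOperator_apply (hu.restrict ι₂) (hc.restrict ι₂ hι₂) v
  have h0 : (fun m => (π.restrict ι₂).integratedOperator (hu.restrict ι₂) (hc.restrict ι₂ hι₂) η₂ (ψ m) v) = fun _ => 0 := funext hw
  rw [h0] at ht
  exact (tendsto_nhds_unique tendsto_const_nhds ht).symm

/-- **(A2), INSTANCE EDITION**: on first-countable locally compact Hausdorff groups with measures positive on opens, Dirac sequences exist (★ `exists_isDiracSequence`), so the pure tensors are
non-degenerate: `(∀ a b, R₁ a (R₂ b v) = 0) → v = 0`. [cite: DeitmarEchterhoff2014, Lemma 6.2.2] -/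
theorem pureTensor_nondegenerate [T2Space G₁] [LocallyCompactSpace G₁] [FirstCountableTopology G₁] [η₁.IsOpenPosMeasure]
    [T2Space G₂] [LocallyCompactSpace G₂] [FirstCountableTopology G₂] [η₂.IsOpenPosMeasure] (v : V)
    (hv : ∀ A ∈ {A : V →L[ℂ] V | ∃ (a : C_c(G₁, ℂ)) (b : C_c(G₂, ℂ)),
      A = (π.restrict ι₁).integratedOperator (hu.restrict ι₁) (hc.restrict ι₁ hι₁) η₁ a ∘L (π.restrict ι₂).integratedOperator (hu.restrict ι₂) (hc.restrict ι₂ hι₂) η₂ b}, A v = 0) :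
    v = 0 := by
  obtain ⟨φ, hφ, -⟩ := exists_isDiracSequence η₁
  obtain ⟨ψ, hψ, -⟩ := exists_isDiracSequence η₂
  exact eq_zero_of_forall_pureTensor_apply_eq_zero π hu hc ι₁ hι₁ ι₂ hι₂ η₁ η₂ hφ hψ v hv

/-! ### §1.3 (C) compression and (S2) separate-variables commutation -/

omit [IsTopologicalGroup G₁] [IsTopologicalGroup G₂] in
/-- **(C) COMPRESSION OF A PURE TENSOR**: for `P` commuting with every `π(ι₂ y)` (E1: the `K_∞`-type projector `P_τ`, an average of the `π(k, 1)`) and `R₂ e ∘ R₂ b ∘ R₂ e = R₂(ebe)` (E1: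
`e = e_{K′}`, `ebe = e⋆b⋆e` by ★ `integratedOperator_comp_integratedOperator`): `(P ∘ R₂ e) ∘ (R₁ a ∘ R₂ b) ∘ (P ∘ R₂ e) = (P ∘ R₁ a ∘ P) ∘ R₂(ebe)` — the compression of `𝓐` by
`P ∘ R₂ e = R(e_τ ⊗ e_{K′})` is again «arch factor ∘ finite factor» (M2 v2 step (ii′)). [cite: Knapp1986, VIII §3] [cite: DeitmarEchterhoff2014, Prop. 6.2.1] -/
theorem compression_pureTensor (hcomm : ∀ (x : G₁) (y : G₂), ι₁ x * ι₂ y = ι₂ y * ι₁ x) (P : V →L[ℂ] V) (hP : ∀ y : G₂, P ∘L π (ι₂ y) = π (ι₂ y) ∘L P)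
    (a : C_c(G₁, ℂ)) (e b ebe : C_c(G₂, ℂ))
    (hebe : (π.restrict ι₂).integratedOperator (hu.restrict ι₂) (hc.restrict ι₂ hι₂) η₂ e ∘L (π.restrict ι₂).integratedOperator (hu.restrict ι₂) (hc.restrict ι₂ hι₂) η₂ b ∘L
      (π.restrict ι₂).integratedOperator (hu.restrict ι₂) (hc.restrict ι₂ hι₂) η₂ e = (π.restrict ι₂).integratedOperator (hu.restrict ι₂) (hc.restrict ι₂ hι₂) η₂ ebe) :
    (P ∘L (π.restrict ι₂).integratedOperator (hu.restrict ι₂) (hc.restrict ι₂ hι₂) η₂ e) ∘L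
        ((π.restrict ι₁).integratedOperator (hu.restrict ι₁) (hc.restrict ι₁ hι₁) η₁ a ∘L (π.restrict ι₂).integratedOperator (hu.restrict ι₂) (hc.restrict ι₂ hι₂) η₂ b) ∘L
        (P ∘L (π.restrict ι₂).integratedOperator (hu.restrict ι₂) (hc.restrict ι₂ hι₂) η₂ e) =
      (P ∘L (π.restrict ι₁).integratedOperator (hu.restrict ι₁) (hc.restrict ι₁ hι₁) η₁ a ∘L P) ∘L (π.restrict ι₂).integratedOperator (hu.restrict ι₂) (hc.restrict ι₂ hι₂) η₂ ebe := by
  have cP : ∀ (f : C_c(G₂, ℂ)) (w : V), P ((π.restrict ι₂).integratedOperator (hu.restrict ι₂) (hc.restrict ι₂ hι₂) η₂ f w) =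
      (π.restrict ι₂).integratedOperator (hu.restrict ι₂) (hc.restrict ι₂ hι₂) η₂ f (P w) := fun f w => by
    rw [← ContinuousLinearMap.comp_apply, comp_integratedOperator_comm_of_forall π hu hc ι₂ hι₂ η₂ P hP f, ContinuousLinearMap.comp_apply]
  have c₁₂ : ∀ (f : C_c(G₂, ℂ)) (w : V), (π.restrict ι₂).integratedOperator (hu.restrict ι₂) (hc.restrict ι₂ hι₂) η₂ f ((π.restrict ι₁).integratedOperator (hu.restrict ι₁) (hc.restrict ι₁ hι₁) η₁ a w) =
      (π.restrict ι₁).integratedOperator (hu.restrict ι₁) (hc.restrict ι₁ hι₁) η₁ a ((π.restrict ι₂).integratedOperator (hu.restrict ι₂) (hc.restrict ι₂ hι₂) η₂ f w) := fun f w => by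
    rw [← ContinuousLinearMap.comp_apply, ← integratedOperator_restrict_comm π hu hc ι₁ hι₁ ι₂ hι₂ η₁ η₂ hcomm a f, ContinuousLinearMap.comp_apply]
  have hebe' : ∀ w : V, (π.restrict ι₂).integratedOperator (hu.restrict ι₂) (hc.restrict ι₂ hι₂) η₂ e ((π.restrict ι₂).integratedOperator (hu.restrict ι₂) (hc.restrict ι₂ hι₂) η₂ b
      ((π.restrict ι₂).integratedOperator (hu.restrict ι₂) (hc.restrict ι₂ hι₂) η₂ e w)) = (π.restrict ι₂).integratedOperator (hu.restrict ι₂) (hc.restrict ι₂ hι₂) η₂ ebe w := fun w => by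
    rw [← hebe]; rfl
  ext v
  simp only [ContinuousLinearMap.comp_apply]
  rw [cP e v, c₁₂ e, hebe', cP ebe]

omit [IsTopologicalGroup G₁] [IsTopologicalGroup G₂] in
/-- **(S2) SEPARATE-VARIABLES COMMUTATION**: `Commute (R₁ h ∘ R₂ e) (P ∘ R₂ t)` for `P` commuting with every `π(ι₂ y)`, `R₁ h` commuting with `P` (E1: `h` `(τ,τ)`-spherical, `P = P_τ`) and
`R₂ e` commuting with `R₂ t` (E1: `e = e_{K′}`, `t` bi-`K′`-invariant, `e⋆t = t⋆e = t`): `(h ⊗ e_{K′}) ⋆ (e_τ ⊗ t) = (h⋆e_τ) ⊗ (e_{K′}⋆t) = (e_τ⋆h) ⊗ (t⋆e_{K′})` — the arch-with-finite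
part of the hypothesis `hTB` of ★ p860278 (amendment #2 (228), (S2)). [cite: Knapp1986, VIII §3] [cite: Gelbart1975, (10.12)–(10.13)] -/
theorem commute_pureTensor_of_separate (hcomm : ∀ (x : G₁) (y : G₂), ι₁ x * ι₂ y = ι₂ y * ι₁ x) (P : V →L[ℂ] V) (hP : ∀ y : G₂, P ∘L π (ι₂ y) = π (ι₂ y) ∘L P)
    (h : C_c(G₁, ℂ)) (e t : C_c(G₂, ℂ))
    (hh : (π.restrict ι₁).integratedOperator (hu.restrict ι₁) (hc.restrict ι₁ hι₁) η₁ h ∘L P = P ∘L (π.restrict ι₁).integratedOperator (hu.restrict ι₁) (hc.restrict ι₁ hι₁) η₁ h)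
    (het : (π.restrict ι₂).integratedOperator (hu.restrict ι₂) (hc.restrict ι₂ hι₂) η₂ e ∘L (π.restrict ι₂).integratedOperator (hu.restrict ι₂) (hc.restrict ι₂ hι₂) η₂ t =
      (π.restrict ι₂).integratedOperator (hu.restrict ι₂) (hc.restrict ι₂ hι₂) η₂ t ∘L (π.restrict ι₂).integratedOperator (hu.restrict ι₂) (hc.restrict ι₂ hι₂) η₂ e) :
    Commute ((π.restrict ι₁).integratedOperator (hu.restrict ι₁) (hc.restrict ι₁ hι₁) η₁ h ∘L (π.restrict ι₂).integratedOperator (hu.restrict ι₂) (hc.restrict ι₂ hι₂) η₂ e)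
      (P ∘L (π.restrict ι₂).integratedOperator (hu.restrict ι₂) (hc.restrict ι₂ hι₂) η₂ t) := by
  have cP : ∀ (f : C_c(G₂, ℂ)) (w : V), P ((π.restrict ι₂).integratedOperator (hu.restrict ι₂) (hc.restrict ι₂ hι₂) η₂ f w) =
      (π.restrict ι₂).integratedOperator (hu.restrict ι₂) (hc.restrict ι₂ hι₂) η₂ f (P w) := fun f w => by
    rw [← ContinuousLinearMap.comp_apply, comp_integratedOperator_comm_of_forall π hu hc ι₂ hι₂ η₂ P hP f, ContinuousLinearMap.comp_apply]
  have c₁₂ : ∀ (f : C_c(G₂, ℂ)) (w : V), (π.restrict ι₂).integratedOperator (hu.restrict ι₂) (hc.restrict ι₂ hι₂) η₂ f ((π.restrict ι₁).integratedOperator (hu.restrict ι₁) (hc.restrict ι₁ hι₁) η₁ h w) =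
      (π.restrict ι₁).integratedOperator (hu.restrict ι₁) (hc.restrict ι₁ hι₁) η₁ h ((π.restrict ι₂).integratedOperator (hu.restrict ι₂) (hc.restrict ι₂ hι₂) η₂ f w) := fun f w => by
    rw [← ContinuousLinearMap.comp_apply, ← integratedOperator_restrict_comm π hu hc ι₁ hι₁ ι₂ hι₂ η₁ η₂ hcomm h f, ContinuousLinearMap.comp_apply]
  have hh' : ∀ w : V, (π.restrict ι₁).integratedOperator (hu.restrict ι₁) (hc.restrict ι₁ hι₁) η₁ h (P w) = P ((π.restrict ι₁).integratedOperator (hu.restrict ι₁) (hc.restrict ι₁ hι₁) η₁ h w) :=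
    fun w => by rw [← ContinuousLinearMap.comp_apply, hh, ContinuousLinearMap.comp_apply]
  have het' : ∀ w : V, (π.restrict ι₂).integratedOperator (hu.restrict ι₂) (hc.restrict ι₂ hι₂) η₂ e ((π.restrict ι₂).integratedOperator (hu.restrict ι₂) (hc.restrict ι₂ hι₂) η₂ t w) =
      (π.restrict ι₂).integratedOperator (hu.restrict ι₂) (hc.restrict ι₂ hι₂) η₂ t ((π.restrict ι₂).integratedOperator (hu.restrict ι₂) (hc.restrict ι₂ hι₂) η₂ e w) :=
    fun w => by rw [← ContinuousLinearMap.comp_apply, het, ContinuousLinearMap.comp_apply]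
  rw [Commute, SemiconjBy, ContinuousLinearMap.mul_def, ContinuousLinearMap.mul_def]
  ext v
  simp only [ContinuousLinearMap.comp_apply]
  rw [← cP e, hh', c₁₂ t, het']

end Generic

/-! ## §2 The E1 print: `G(𝔸) = U(H)(L⁺ ⊗ ℝ) · U(H)(𝔸_{L⁺,f})` at ★ `cmDatum L N H` -/

section CM

variable {L : Type} [Field L] [NumberField L] [IsCMField L] {N : ℕ} {H : Matrix (Fin N) (Fin N) L}

/-- `(g_∞, 1)` and `(1, g_f)` commute, in the shape `hcomm`. [folklore] -/
theorem cm_hcomm (x : UnitaryGroup.arch (↥(maximalRealSubfield L)) L (IsCMField.complexConj L) N H) (y : finAdelic (↥(maximalRealSubfield L)) L (IsCMField.complexConj L) N H) :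
    archToAdelic (↥(maximalRealSubfield L)) L (IsCMField.complexConj L) N H x * finAdelicToAdelic (↥(maximalRealSubfield L)) L (IsCMField.complexConj L) N H y =
      finAdelicToAdelic (↥(maximalRealSubfield L)) L (IsCMField.complexConj L) N H y * archToAdelic (↥(maximalRealSubfield L)) L (IsCMField.complexConj L) N H x :=
  (commute_archToAdelic_finAdelicToAdelic (↥(maximalRealSubfield L)) L (IsCMField.complexConj L) N H x y).eq

/-- Every `g ∈ G(𝔸)` is `(g_∞, 1) · (1, g_f)`, in the shape `hsurj`. [folklore] -/
theorem cm_hsurj (g : (cmDatum L N H).Adelic) :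
    ∃ (x : UnitaryGroup.arch (↥(maximalRealSubfield L)) L (IsCMField.complexConj L) N H) (y : finAdelic (↥(maximalRealSubfield L)) L (IsCMField.complexConj L) N H),
      g = archToAdelic (↥(maximalRealSubfield L)) L (IsCMField.complexConj L) N H x * finAdelicToAdelic (↥(maximalRealSubfield L)) L (IsCMField.complexConj L) N H y :=
  ⟨_, _, (archToAdelic_mul_finAdelicToAdelic (↥(maximalRealSubfield L)) L (IsCMField.complexConj L) N H g).symm⟩

variable {V : Type*} [NormedAddCommGroup V] [InnerProductSpace ℂ V] [CompleteSpace V]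
  (π : ContRepresentation ℂ (cmDatum L N H).Adelic V) (hu : π.IsUnitary) (hc : π.IsStronglyContinuous)
  [MeasurableSpace (UnitaryGroup.arch (↥(maximalRealSubfield L)) L (IsCMField.complexConj L) N H)] [BorelSpace (UnitaryGroup.arch (↥(maximalRealSubfield L)) L (IsCMField.complexConj L) N H)]
  [MeasurableSpace (finAdelic (↥(maximalRealSubfield L)) L (IsCMField.complexConj L) N H)] [BorelSpace (finAdelic (↥(maximalRealSubfield L)) L (IsCMField.complexConj L) N H)]
  (νinf : Measure (UnitaryGroup.arch (↥(maximalRealSubfield L)) L (IsCMField.complexConj L) N H)) [IsFiniteMeasureOnCompacts νinf]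
  (νf : Measure (finAdelic (↥(maximalRealSubfield L)) L (IsCMField.complexConj L) N H)) [IsFiniteMeasureOnCompacts νf]

/-- **(A1) for `U(H)(𝔸_{L⁺})`: the pure tensors `{π_∞(a) ∘ π_f(b)}` are translation-stable** — ★ p860278's `h𝓐` verbatim (left-invariant `ν_∞, ν_f`). [cite: DeitmarEchterhoff2014, Prop. 6.2.1] [cite: Gelbart1975, (10.12)–(10.13)] -/
theorem cm_comp_pureTensor_mem [νinf.IsMulLeftInvariant] [νf.IsMulLeftInvariant] :
    ∀ (g : (cmDatum L N H).Adelic), ∀ A ∈ {A : V →L[ℂ] V | ∃ (a : C_c(UnitaryGroup.arch (↥(maximalRealSubfield L)) L (IsCMField.complexConj L) N H, ℂ))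
        (b : C_c(finAdelic (↥(maximalRealSubfield L)) L (IsCMField.complexConj L) N H, ℂ)),
      A = (π.restrict (archToAdelic (↥(maximalRealSubfield L)) L (IsCMField.complexConj L) N H)).integratedOperator (hu.restrict _)
            (hc.restrict _ (continuous_archToAdelic (↥(maximalRealSubfield L)) L (IsCMField.complexConj L) N H)) νinf a ∘L
          (π.restrict (finAdelicToAdelic (↥(maximalRealSubfield L)) L (IsCMField.complexConj L) N H)).integratedOperator (hu.restrict _)
            (hc.restrict _ (continuous_finAdelicToAdelic (↥(maximalRealSubfield L)) L (IsCMField.complexConj L) N H)) νf b},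
      (π g).comp A ∈ {A : V →L[ℂ] V | ∃ (a : C_c(UnitaryGroup.arch (↥(maximalRealSubfield L)) L (IsCMField.complexConj L) N H, ℂ))
        (b : C_c(finAdelic (↥(maximalRealSubfield L)) L (IsCMField.complexConj L) N H, ℂ)),
      A = (π.restrict (archToAdelic (↥(maximalRealSubfield L)) L (IsCMField.complexConj L) N H)).integratedOperator (hu.restrict _)
            (hc.restrict _ (continuous_archToAdelic (↥(maximalRealSubfield L)) L (IsCMField.complexConj L) N H)) νinf a ∘L
          (π.restrict (finAdelicToAdelic (↥(maximalRealSubfield L)) L (IsCMField.complexConj L) N H)).integratedOperator (hu.restrict _)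
            (hc.restrict _ (continuous_finAdelicToAdelic (↥(maximalRealSubfield L)) L (IsCMField.complexConj L) N H)) νf b} :=
  fun g A hA => comp_pureTensor_mem π hu hc (archToAdelic (↥(maximalRealSubfield L)) L (IsCMField.complexConj L) N H) (continuous_archToAdelic (↥(maximalRealSubfield L)) L (IsCMField.complexConj L) N H)
    (finAdelicToAdelic (↥(maximalRealSubfield L)) L (IsCMField.complexConj L) N H) (continuous_finAdelicToAdelic (↥(maximalRealSubfield L)) L (IsCMField.complexConj L) N H) νinf νf cm_hcomm cm_hsurj g A hA

/-- **(A3) for `U(H)(𝔸_{L⁺})`: the pure tensors are `†`-stable** — ★ p860278's `hstar` verbatim (inversion-invariant `ν_∞, ν_f`). [cite: DeitmarEchterhoff2014, Prop. 6.2.1] [cite: Gelbart1975, Lemma 10.6] -/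
theorem cm_adjoint_pureTensor_mem [νinf.IsInvInvariant] [νf.IsInvInvariant] :
    ∀ A ∈ {A : V →L[ℂ] V | ∃ (a : C_c(UnitaryGroup.arch (↥(maximalRealSubfield L)) L (IsCMField.complexConj L) N H, ℂ))
        (b : C_c(finAdelic (↥(maximalRealSubfield L)) L (IsCMField.complexConj L) N H, ℂ)),
      A = (π.restrict (archToAdelic (↥(maximalRealSubfield L)) L (IsCMField.complexConj L) N H)).integratedOperator (hu.restrict _)
            (hc.restrict _ (continuous_archToAdelic (↥(maximalRealSubfield L)) L (IsCMField.complexConj L) N H)) νinf a ∘L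
          (π.restrict (finAdelicToAdelic (↥(maximalRealSubfield L)) L (IsCMField.complexConj L) N H)).integratedOperator (hu.restrict _)
            (hc.restrict _ (continuous_finAdelicToAdelic (↥(maximalRealSubfield L)) L (IsCMField.complexConj L) N H)) νf b},
      ContinuousLinearMap.adjoint A ∈ {A : V →L[ℂ] V | ∃ (a : C_c(UnitaryGroup.arch (↥(maximalRealSubfield L)) L (IsCMField.complexConj L) N H, ℂ))
        (b : C_c(finAdelic (↥(maximalRealSubfield L)) L (IsCMField.complexConj L) N H, ℂ)),
      A = (π.restrict (archToAdelic (↥(maximalRealSubfield L)) L (IsCMField.complexConj L) N H)).integratedOperator (hu.restrict _)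
            (hc.restrict _ (continuous_archToAdelic (↥(maximalRealSubfield L)) L (IsCMField.complexConj L) N H)) νinf a ∘L
          (π.restrict (finAdelicToAdelic (↥(maximalRealSubfield L)) L (IsCMField.complexConj L) N H)).integratedOperator (hu.restrict _)
            (hc.restrict _ (continuous_finAdelicToAdelic (↥(maximalRealSubfield L)) L (IsCMField.complexConj L) N H)) νf b} :=
  fun A hA => adjoint_pureTensor_mem π hu hc (archToAdelic (↥(maximalRealSubfield L)) L (IsCMField.complexConj L) N H) (continuous_archToAdelic (↥(maximalRealSubfield L)) L (IsCMField.complexConj L) N H)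
    (finAdelicToAdelic (↥(maximalRealSubfield L)) L (IsCMField.complexConj L) N H) (continuous_finAdelicToAdelic (↥(maximalRealSubfield L)) L (IsCMField.complexConj L) N H) νinf νf cm_hcomm A hA

/-- **(A2) for `U(H)(𝔸_{L⁺})`: the pure tensors are non-degenerate along Dirac sequences** — ★ p860278's `hnd` (Dirac sequences `φ` on `G_∞`, `ψ` on `G_f`; they exist by ★ `exists_isDiracSequence`).
[cite: DeitmarEchterhoff2014, Lemma 6.2.2] -/
theorem cm_eq_zero_of_forall_pureTensor_apply_eq_zero {φ : ℕ → C_c(UnitaryGroup.arch (↥(maximalRealSubfield L)) L (IsCMField.complexConj L) N H, ℂ)}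
    {ψ : ℕ → C_c(finAdelic (↥(maximalRealSubfield L)) L (IsCMField.complexConj L) N H, ℂ)} (hφ : IsDiracSequence νinf φ) (hψ : IsDiracSequence νf ψ) :
    ∀ v : V, (∀ A ∈ {A : V →L[ℂ] V | ∃ (a : C_c(UnitaryGroup.arch (↥(maximalRealSubfield L)) L (IsCMField.complexConj L) N H, ℂ))
        (b : C_c(finAdelic (↥(maximalRealSubfield L)) L (IsCMField.complexConj L) N H, ℂ)),
      A = (π.restrict (archToAdelic (↥(maximalRealSubfield L)) L (IsCMField.complexConj L) N H)).integratedOperator (hu.restrict _)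
            (hc.restrict _ (continuous_archToAdelic (↥(maximalRealSubfield L)) L (IsCMField.complexConj L) N H)) νinf a ∘L
          (π.restrict (finAdelicToAdelic (↥(maximalRealSubfield L)) L (IsCMField.complexConj L) N H)).integratedOperator (hu.restrict _)
            (hc.restrict _ (continuous_finAdelicToAdelic (↥(maximalRealSubfield L)) L (IsCMField.complexConj L) N H)) νf b}, A v = 0) → v = 0 :=
  fun v hv => eq_zero_of_forall_pureTensor_apply_eq_zero π hu hc (archToAdelic (↥(maximalRealSubfield L)) L (IsCMField.complexConj L) N H) (continuous_archToAdelic (↥(maximalRealSubfield L)) L (IsCMField.complexConj L) N H)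
    (finAdelicToAdelic (↥(maximalRealSubfield L)) L (IsCMField.complexConj L) N H) (continuous_finAdelicToAdelic (↥(maximalRealSubfield L)) L (IsCMField.complexConj L) N H) νinf νf hφ hψ v hv

end CM

end Summit.HodgeConjecture.HodgeConjecture.Cruxes.H413.K2E1PureTensorHeckeAlgebraU

end
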